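import Summits.HodgeConjecture.HodgeConjecture.Theorems.F0P2dStubHProjectedL2Data
import Literature.NumberTheory.Automorphic.UnitaryCurveCohCotangentForms
import Literature.NumberTheory.Automorphic.UnitaryGroupArchSection
import HarnessLib

/-!
# Crux `HLiu418`, K-lane sub-line `F0_P5TP2SpectralProjection` — stub **(H₂)** `stub_H₂`: the spectral projection `pr_P` TRANSPORTS
# the rank-2 `L²`-level cotangent data (A hand A-p02 (g18); served item `stmt-HodgeConjecture-24832`, `--as helper`)

HC_CM is proved only modulo the 7 printed citations until rung 0 closes.

The K-lane sub-line `Cruxes/HLiu418/Lines/F0_P5TP2SpectralProjection.lean` (skeleton v0 `A-provers/A-p14/g16/TP2/…skeleton-v0.lean`,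
sha16 ce659ab5fe57535c, A-p14 (g16); rank-2 chart-free twin of the 24833 (D)-line) cuts the P5 named fact TP₂
`UnitaryCurveForms.holCotFormSpectralProjection₂` into the stubs N₂ ∕ K₂ ∕ S₂ ∕ H₂ ∕ R₂ ∕ G₂ ∕ T₂.  Stub (H₂) says: for every discrete
automorphic `P` of `U(H)(𝔸_{L⁺})` (`H` of rank 2) and every `L²` class `u` carrying the rank-2 `L²`-LEVEL COTANGENT DATA `IsL2CotPair₁ … ν A u`
— reproduction `T_A u = u` by a SCALAR kernel `A` on `U(σ_{w₁}H)(ℂ)` (`kernelOp₁`), right `K_c`-invariance, right invariance under an open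
`K_f ≤ U(H)(𝔸_{L⁺,f})`, the SCALAR cotangent `K_∞`-type relation `R(sec κ) u = (a k⁻¹) • u` in the cone frame's coordinates, differentiability
at `0` of the one-variable `𝔭`-orbit map `z ↦ R(sec (γ z)) u` and weak (`L²`) Cauchy–Riemann — the projected class `pr_P u` carries the same data.

WHY — verbatim the rank-3 reason ([BorelJacquet1979, §4.6]; [Bump1997, proof of Thm. 3.6.1, p. 342]): `pr_P` is a continuous `ℂ`-linear map
commuting with every `R(g)`; it commutes with the Bochner integral `∫ A(t) • R(sec t) · dν(t)` WITHOUT any integrability hypothesis (★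
`F0P2dStubHProjectedL2Data.starProjection_integral_smul_rightRegular'`, A-p06 (g18), `AdelicGroupData`-generic), with invariances and scalar type
relations (★ `rightRegular_starProjection_of_forall`, ★ `starProjection_rightRegular`), and the `𝔭`-orbit map of `pr_P u` is `pr_P ∘` that of `u`
(★ `differentiableAt_rightRegular_starProjection`, ★ `fderiv_rightRegular_starProjection_apply`, any real normed parameter space — here `ℂ`)
[DeitmarEchterhoff2014, Thm. 7.3.2].  This file is the ONE-COORDINATE RE-INSTANTIATION; no mathematics is new.

THE CLOSER `stubH₂_holds` has as TYPE the body of the line's `def StubH₂ProjectedL2Data : Prop` (v0 :271) with the Lines-local bundles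
UNFOLDED (s347; nothing imports a `Lines` module): `G2 L H` ↦ `adelicGroupData L⁺ L c̄ 2 H`, `sec₁ L ι H` ↦ `adelicSingle … (cmPlace L ι)`,
`Kc₁ L ι H` ↦ its body, `kernelOp₁`∕`orbitP₁`∕`IsWeaklyHol₁` ↦ their bodies, and the `Prop`-structure `IsL2CotPair₁ … u` (6 fields
`repro kc kf ktype diffOrbit weakHol`) ↦ its six fields IN ORDER, as six hypotheses (for `u`) and a six-fold conjunction (for `pr_P u`).  The line's
edition then reads `theorem stub_H₂ : StubH₂ProjectedL2Data := fun L _ _ _ ι H 𝔣 γ μ _ _ _ ν _ A P u hu =>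
  let h := F0P5TP2StubH2ProjectedL2Data.stubH₂_holds L ι H 𝔣 γ μ ν A P u hu.repro hu.kc hu.kf hu.ktype hu.diffOrbit hu.weakHol;
  ⟨h.1, h.2.1, h.2.2.1, h.2.2.2.1, h.2.2.2.2.1, h.2.2.2.2.2⟩`.

No definition, no named fact, no `sorry`; imports ★ `Theorems/F0P2dStubHProjectedL2Data` (the generic §1), ★ `UnitaryCurveCohCotangentForms`
(`ConeFrame`), ★ `UnitaryGroupArchSection` (`archLocal`, `adelicSingle`, `cmPlace`, `continuous_adelicSingle`).

## References
* [BorelJacquet1979] A. Borel, H. Jacquet, *Automorphic forms and automorphic representations*, PSPM 33.1 (1979), §4.6.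
* [Bump1997] D. Bump, *Automorphic forms and representations* (1997), proof of Thm. 3.6.1, p. 342.
* [DeitmarEchterhoff2014] A. Deitmar, S. Echterhoff, *Principles of Harmonic Analysis*, 2nd ed. (2014), Thm. 7.3.2.
-/

-- the mandated namespace repeats `HodgeConjecture.HodgeConjecture`, as in every `Theorems/*.lean` of this sub-problem
set_option linter.dupNamespace false

noncomputable section

open MeasureTheory NumberField NumberField.InfinitePlace
open scoped Matrix ComplexOrder

namespace Summit.HodgeConjecture.HodgeConjecture.Cruxes.HLiu418.F0P5TP2StubH2ProjectedL2Data

open Literature.NumberTheory.Automorphic Literature.NumberTheory.Automorphic.UnitaryGroup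
open Literature.NumberTheory.Automorphic.UnitaryCurveForms
open Summit.HodgeConjecture.HodgeConjecture.Cruxes.H413.F0P2dStubHProjectedL2Data

/-- **(H₂) `pr_P` transports the rank-2 `L²`-level cotangent data** — stub `stub_H₂ : StubH₂ProjectedL2Data` of
`Cruxes/HLiu418/Lines/F0_P5TP2SpectralProjection.lean` (skeleton v0 ce659ab5fe57535c), body VERBATIM with the Lines-local bundles unfolded
(`G2` ↦ `adelicGroupData L⁺ L c̄ 2 H`; `sec₁` ↦ `adelicSingle … (cmPlace L ι)`; `Kc₁`, `kernelOp₁`, `orbitP₁`, `IsWeaklyHol₁` ↦ their bodies; the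
`Prop`-structure `IsL2CotPair₁ … u` ↦ its six fields `repro ∕ kc ∕ kf ∕ ktype ∕ diffOrbit ∕ weakHol` in order, as hypotheses for `u` and as a
conjunction for `pr_P u`).  For every discrete automorphic `P` the projected class is again reproduced by the scalar kernel `A`
(`pr_P ∘ T_A = T_A ∘ pr_P`, no regularity of `A` needed), `K_c`- and `K_f`-invariant, of the same scalar cotangent `K_∞`-type, with a differentiable
one-variable `𝔭`-orbit map satisfying weak Cauchy–Riemann. [cite: BorelJacquet1979, §4.6] [cite: Bump1997, Thm. 3.6.1 (proof, p. 342)]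
[cite: DeitmarEchterhoff2014, Thm. 7.3.2] -/
theorem stubH₂_holds :
    ∀ (L : Type) [Field L] [NumberField L] [IsCMField L] (ι : L →+* ℂ) (H : Matrix (Fin 2) (Fin 2) L)
    (𝔣 : ConeFrame L H (cmPlace L ι)) (γ : ℂ → archLocal L 2 H (cmPlace L ι))
    (μ : Measure (adelicGroupData (↥(maximalRealSubfield L)) L (IsCMField.complexConj L) 2 H).automorphicQuotient)
    [(adelicGroupData (↥(maximalRealSubfield L)) L (IsCMField.complexConj L) 2 H).IsAutomorphicMeasure μ]
    [MeasurableSpace (archLocal L 2 H (cmPlace L ι))] [BorelSpace (archLocal L 2 H (cmPlace L ι))]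
    (ν : Measure (archLocal L 2 H (cmPlace L ι))) [ν.IsHaarMeasure] (A : archLocal L 2 H (cmPlace L ι) → ℂ)
    (P : DiscreteAutomorphicRep (adelicGroupData (↥(maximalRealSubfield L)) L (IsCMField.complexConj L) 2 H) μ)
    (u : (adelicGroupData (↥(maximalRealSubfield L)) L (IsCMField.complexConj L) 2 H).L2 μ),
    -- `IsL2CotPair₁ L ι H 𝔣 γ μ ν A u`, field by field
    ((∫ t, A t • (adelicGroupData (↥(maximalRealSubfield L)) L (IsCMField.complexConj L) 2 H).rightRegular μ
        (adelicSingle (↥(maximalRealSubfield L)) L (IsCMField.complexConj L) 2 H (IsCMField.complexConj_ne_one L)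
          (UnitaryGroup.complexConj_smul_infinitePlace L) (cmPlace L ι) t) u ∂ν) = u) →
    (∀ k ∈ ((archAt (↥(maximalRealSubfield L)) L (IsCMField.complexConj L) 2 H (cmPlace L ι)
        (UnitaryGroup.complexConj_smul_infinitePlace L (cmPlace L ι).1) (IsCMField.complexConj_ne_one L)).ker).map
        (archToAdelic (↥(maximalRealSubfield L)) L (IsCMField.complexConj L) 2 H),
      (adelicGroupData (↥(maximalRealSubfield L)) L (IsCMField.complexConj L) 2 H).rightRegular μ k u = u) →
    (∃ Kf : Subgroup (finAdelic (↥(maximalRealSubfield L)) L (IsCMField.complexConj L) 2 H),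
      IsOpen (Kf : Set (finAdelic (↥(maximalRealSubfield L)) L (IsCMField.complexConj L) 2 H)) ∧
        ∀ k ∈ Kf, (adelicGroupData (↥(maximalRealSubfield L)) L (IsCMField.complexConj L) 2 H).rightRegular μ
          (finAdelicToAdelic (↥(maximalRealSubfield L)) L (IsCMField.complexConj L) 2 H k) u = u) →
    (∀ (κ : archLocal L 2 H (cmPlace L ι)) (a k d : ℂ), k ≠ 0 →
      ((κ : GL (Fin 2) ℂ) : Matrix (Fin 2) (Fin 2) ℂ) *ᵥ 𝔣.v₀ = k • 𝔣.v₀ →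
      ((κ : GL (Fin 2) ℂ) : Matrix (Fin 2) (Fin 2) ℂ) *ᵥ 𝔣.t₀ = a • 𝔣.t₀ + d • 𝔣.v₀ →
        (adelicGroupData (↥(maximalRealSubfield L)) L (IsCMField.complexConj L) 2 H).rightRegular μ
          (adelicSingle (↥(maximalRealSubfield L)) L (IsCMField.complexConj L) 2 H (IsCMField.complexConj_ne_one L)
            (UnitaryGroup.complexConj_smul_infinitePlace L) (cmPlace L ι) κ) u = (a * k⁻¹) • u) →
    (DifferentiableAt ℝ (fun z : ℂ => (adelicGroupData (↥(maximalRealSubfield L)) L (IsCMField.complexConj L) 2 H).rightRegular μ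
        (adelicSingle (↥(maximalRealSubfield L)) L (IsCMField.complexConj L) 2 H (IsCMField.complexConj_ne_one L)
          (UnitaryGroup.complexConj_smul_infinitePlace L) (cmPlace L ι) (γ z)) u) 0) →
    (∀ z : ℂ, fderiv ℝ (fun z : ℂ => (adelicGroupData (↥(maximalRealSubfield L)) L (IsCMField.complexConj L) 2 H).rightRegular μ
        (adelicSingle (↥(maximalRealSubfield L)) L (IsCMField.complexConj L) 2 H (IsCMField.complexConj_ne_one L)
          (UnitaryGroup.complexConj_smul_infinitePlace L) (cmPlace L ι) (γ z)) u) 0 (Complex.I • z) =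
      Complex.I • fderiv ℝ (fun z : ℂ => (adelicGroupData (↥(maximalRealSubfield L)) L (IsCMField.complexConj L) 2 H).rightRegular μ
        (adelicSingle (↥(maximalRealSubfield L)) L (IsCMField.complexConj L) 2 H (IsCMField.complexConj_ne_one L)
          (UnitaryGroup.complexConj_smul_infinitePlace L) (cmPlace L ι) (γ z)) u) 0 z) →
    -- `IsL2CotPair₁ L ι H 𝔣 γ μ ν A (pr_P u)`, field by field
    ((∫ t, A t • (adelicGroupData (↥(maximalRealSubfield L)) L (IsCMField.complexConj L) 2 H).rightRegular μ
        (adelicSingle (↥(maximalRealSubfield L)) L (IsCMField.complexConj L) 2 H (IsCMField.complexConj_ne_one L)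
          (UnitaryGroup.complexConj_smul_infinitePlace L) (cmPlace L ι) t) (P.space.toSubmodule.starProjection u) ∂ν) =
        P.space.toSubmodule.starProjection u) ∧
    (∀ k ∈ ((archAt (↥(maximalRealSubfield L)) L (IsCMField.complexConj L) 2 H (cmPlace L ι)
        (UnitaryGroup.complexConj_smul_infinitePlace L (cmPlace L ι).1) (IsCMField.complexConj_ne_one L)).ker).map
        (archToAdelic (↥(maximalRealSubfield L)) L (IsCMField.complexConj L) 2 H),
      (adelicGroupData (↥(maximalRealSubfield L)) L (IsCMField.complexConj L) 2 H).rightRegular μ k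
        (P.space.toSubmodule.starProjection u) = P.space.toSubmodule.starProjection u) ∧
    (∃ Kf : Subgroup (finAdelic (↥(maximalRealSubfield L)) L (IsCMField.complexConj L) 2 H),
      IsOpen (Kf : Set (finAdelic (↥(maximalRealSubfield L)) L (IsCMField.complexConj L) 2 H)) ∧
        ∀ k ∈ Kf, (adelicGroupData (↥(maximalRealSubfield L)) L (IsCMField.complexConj L) 2 H).rightRegular μ
          (finAdelicToAdelic (↥(maximalRealSubfield L)) L (IsCMField.complexConj L) 2 H k)
            (P.space.toSubmodule.starProjection u) = P.space.toSubmodule.starProjection u) ∧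
    (∀ (κ : archLocal L 2 H (cmPlace L ι)) (a k d : ℂ), k ≠ 0 →
      ((κ : GL (Fin 2) ℂ) : Matrix (Fin 2) (Fin 2) ℂ) *ᵥ 𝔣.v₀ = k • 𝔣.v₀ →
      ((κ : GL (Fin 2) ℂ) : Matrix (Fin 2) (Fin 2) ℂ) *ᵥ 𝔣.t₀ = a • 𝔣.t₀ + d • 𝔣.v₀ →
        (adelicGroupData (↥(maximalRealSubfield L)) L (IsCMField.complexConj L) 2 H).rightRegular μ
          (adelicSingle (↥(maximalRealSubfield L)) L (IsCMField.complexConj L) 2 H (IsCMField.complexConj_ne_one L)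
            (UnitaryGroup.complexConj_smul_infinitePlace L) (cmPlace L ι) κ) (P.space.toSubmodule.starProjection u) =
          (a * k⁻¹) • P.space.toSubmodule.starProjection u) ∧
    (DifferentiableAt ℝ (fun z : ℂ => (adelicGroupData (↥(maximalRealSubfield L)) L (IsCMField.complexConj L) 2 H).rightRegular μ
        (adelicSingle (↥(maximalRealSubfield L)) L (IsCMField.complexConj L) 2 H (IsCMField.complexConj_ne_one L)
          (UnitaryGroup.complexConj_smul_infinitePlace L) (cmPlace L ι) (γ z)) (P.space.toSubmodule.starProjection u)) 0) ∧
    (∀ z : ℂ, fderiv ℝ (fun z : ℂ => (adelicGroupData (↥(maximalRealSubfield L)) L (IsCMField.complexConj L) 2 H).rightRegular μ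
        (adelicSingle (↥(maximalRealSubfield L)) L (IsCMField.complexConj L) 2 H (IsCMField.complexConj_ne_one L)
          (UnitaryGroup.complexConj_smul_infinitePlace L) (cmPlace L ι) (γ z)) (P.space.toSubmodule.starProjection u)) 0 (Complex.I • z) =
      Complex.I • fderiv ℝ (fun z : ℂ => (adelicGroupData (↥(maximalRealSubfield L)) L (IsCMField.complexConj L) 2 H).rightRegular μ
        (adelicSingle (↥(maximalRealSubfield L)) L (IsCMField.complexConj L) 2 H (IsCMField.complexConj_ne_one L)
          (UnitaryGroup.complexConj_smul_infinitePlace L) (cmPlace L ι) (γ z)) (P.space.toSubmodule.starProjection u)) 0 z) := by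
  intro L _ _ _ ι H 𝔣 γ μ _ _ _ ν _ A P u hrepro hkc hkf hktype hdiff hweak
  -- the archimedean section at `w₁` is continuous (★ `continuous_adelicSingle`)
  have hc : Continuous (adelicSingle (↥(maximalRealSubfield L)) L (IsCMField.complexConj L) 2 H (IsCMField.complexConj_ne_one L)
      (UnitaryGroup.complexConj_smul_infinitePlace L) (cmPlace L ι)) := continuous_adelicSingle _ _ _ _ _ _ _ _
  -- `U(σ_{w₁}H)(ℂ) ≤ GL₂(ℂ)` is second countable (what the Bochner-integral commutation lemma asks of the parameter space)
  haveI : SecondCountableTopology (Matrix (Fin 2) (Fin 2) ℂ) :=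
    inferInstanceAs (SecondCountableTopology (Fin 2 → Fin 2 → ℂ))
  haveI : SecondCountableTopology (Matrix (Fin 2) (Fin 2) ℂ)ᵐᵒᵖ := MulOpposite.opHomeomorph.symm.secondCountableTopology
  haveI : SecondCountableTopology (GL (Fin 2) ℂ) := Units.isEmbedding_embedProduct.secondCountableTopology
  haveI : SecondCountableTopology (archLocal L 2 H (cmPlace L ι)) := TopologicalSpace.Subtype.secondCountableTopology _
  refine ⟨?_, fun k hk => ?_, ?_, fun κ a k d hk hv ht => ?_, ?_, fun z => ?_⟩
  · -- repro: `pr_P` through the Bochner integral, no integrability needed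
    rw [← starProjection_integral_smul_rightRegular' P ν hc A u, hrepro]
  · -- kc
    exact P.rightRegular_starProjection_of_forall _ hkc hk
  · -- kf
    obtain ⟨Kf, hKo, hKf⟩ := hkf
    refine ⟨Kf, hKo, fun k hk => ?_⟩
    rw [← P.starProjection_rightRegular, hKf k hk]
  · -- ktype (scalar)
    rw [← P.starProjection_rightRegular, hktype κ a k d hk hv ht, map_smul]
  · -- diffOrbit
    exact differentiableAt_rightRegular_starProjection P (fun z => adelicSingle (↥(maximalRealSubfield L)) L
      (IsCMField.complexConj L) 2 H (IsCMField.complexConj_ne_one L) (UnitaryGroup.complexConj_smul_infinitePlace L)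
        (cmPlace L ι) (γ z)) u hdiff
  · -- weakHol (one coordinate)
    rw [fderiv_rightRegular_starProjection_apply P _ u hdiff, fderiv_rightRegular_starProjection_apply P _ u hdiff, hweak z,
      map_smul]

end Summit.HodgeConjecture.HodgeConjecture.Cruxes.HLiu418.F0P5TP2StubH2ProjectedL2Data

end
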